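import Literature.NumberTheory.LFunctions.XiHigherDerivativesCriticalStrip
import Literature.NumberTheory.LFunctions.RiemannHypothesisUpTo101
import HarnessLib

/-!
# Zeros of `ξ^{(m)}` off the critical line are shadowed by zeros of `ζ` off the line; all zeros of `ξ^{(m)}` up to height `101 − m/2` are on the line

RH-FREE (every statement below is an unconditional theorem of this tree; nothing here bears on the truth
of RH). Topic `Literature/NumberTheory/LFunctions`, namespace `Literature.NumberTheory.LFunctions`
(helpers in `XiDerivOffLine`). A LOCALISED form of the heredity statement "RH ⇒ all zeros of `ξ^{(m)}`
are on `σ = ½`" (Conrey 1983 §1, tree `riemannHypothesis_imp_iteratedDeriv_riemannXi_zeros_on_line`),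
obtained by iterating Jensen's circle theorem (Ki–Kim 2000 §2 p. 50; tree
`jensen_circle_iteratedDeriv_pos`, `Literature/Analysis/Complex/JensenCircles.lean`) for the real entire
function `Ξ(z) = ξ(½ + iz)` of order `< 2` none of whose derivatives vanishes identically:

* `XiDerivOffLine.exists_zero_of_iteratedDeriv_riemannXiUpper` — a zero `w` of `Ξ^{(m)}` with `Im w > 0`
  lies under a zero `a` of `Ξ` with `Im a ≥ Im w` and `|Re w − Re a| ≤ m · Im a`;
* **`exists_offline_zeta_zero_of_iteratedDeriv_riemannXi_eq_zero`** — in `ξ`-language: if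
  `ξ^{(m)}(s) = 0` with `Re s ≠ ½`, there is a zero `ρ` of `ζ` in the critical strip OFF the line, at
  least as far from the line (`|Re ρ − ½| ≥ |Re s − ½|`) and at height `|Im ρ − Im s| ≤ m |Re ρ − ½| < m/2`;
* **`iteratedDeriv_riemannXi_zeros_on_line_of_rhUpTo`** — RH up to height `T`
  (`RiemannHypothesisInStripUpTo T`) puts every zero of `ξ^{(m)}` with `|Im s| ≤ T − m/2` on the line;
* **`iteratedDeriv_riemannXi_zeros_on_line_upTo`** — with the tree's kernel-checked certificate
  `riemannHypothesisInStripUpTo_hundredOne` (RH up to height `101`): every zero of `ξ^{(m)}` with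
  `|Im s| ≤ 101 − m/2` lies on `Re s = ½`; e.g. all zeros of `ξ′` with `|Im s| ≤ 100.5`.

AI-produced formalisation (literature-prover-rh-lit-frontier-1-g12-0, 2026-08-27); AI review is weaker
than expert review.
-/

noncomputable section

open Complex Filter Set
open scoped Real Topology ComplexConjugate

namespace Literature.NumberTheory.LFunctions

open Literature.Analysis.Complex

namespace XiDerivOffLine

/-- **Iterated Jensen circles for `Ξ`**: a zero `w` of `Ξ^{(m)}` with `Im w > 0` lies under a zero `a` of
`Ξ` with `0 < Im w ≤ Im a` and `|Re w − Re a| ≤ m · Im a`. [cite: KiKim2000, §2 p. 50 (Jensen's theorem)] -/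
theorem exists_zero_of_iteratedDeriv_riemannXiUpper (m : ℕ) {w : ℂ}
    (hw : iteratedDeriv m riemannXiUpper w = 0) (hwim : 0 < w.im) :
    ∃ a : ℂ, riemannXiUpper a = 0 ∧ 0 < a.im ∧ w.im ≤ a.im ∧ |w.re - a.re| ≤ m * a.im := by
  obtain ⟨ρ, C, hρ0, hρ, hgr⟩ := exists_growth_riemannXiUpper
  induction m generalizing w with
  | zero =>
    refine ⟨w, by simpa using hw, hwim, le_rfl, ?_⟩
    simp
  | succ m ih =>
    obtain ⟨a₁, ha₁, ha₁im, hdisc⟩ := jensen_circle_iteratedDeriv_pos XiDerivStrip.differentiable_xiUpper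
      hρ0 hρ hgr im_riemannXiUpper_ofReal_holds iteratedDeriv_riemannXiUpper_ne_zero m hwim hw
    obtain ⟨a, ha, haim, h1, h2⟩ := ih ha₁ ha₁im
    have hw1 : w.im ≤ a₁.im := by nlinarith [sq_nonneg (w.re - a₁.re)]
    have hw2 : |w.re - a₁.re| ≤ a₁.im := by
      rw [← Real.sqrt_sq ha₁im.le, ← Real.sqrt_sq_eq_abs]
      exact Real.sqrt_le_sqrt (by nlinarith)
    refine ⟨a, ha, haim, hw1.trans h1, ?_⟩
    have h3 : |w.re - a.re| ≤ |w.re - a₁.re| + |a₁.re - a.re| := abs_sub_le _ _ _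
    push_cast
    nlinarith

/-- Symmetric form: a non-real zero `w` of `Ξ^{(m)}` lies under a non-real zero `a` of `Ξ` with
`|Im w| ≤ |Im a|` and `|Re w − Re a| ≤ m |Im a|`. [cite: KiKim2000, §2 p. 50 (Jensen's theorem)] -/
theorem exists_zero_of_iteratedDeriv_riemannXiUpper' (m : ℕ) {w : ℂ}
    (hw : iteratedDeriv m riemannXiUpper w = 0) (hwim : w.im ≠ 0) :
    ∃ a : ℂ, riemannXiUpper a = 0 ∧ a.im ≠ 0 ∧ |w.im| ≤ |a.im| ∧ |w.re - a.re| ≤ m * |a.im| := by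
  rcases lt_or_gt_of_ne hwim with hneg | hpos
  · have hrefl : iteratedDeriv m riemannXiUpper (conj w) = 0 := by
      rw [apply_conj_eq_conj (differentiable_iteratedDeriv_of_entire XiDerivStrip.differentiable_xiUpper m)
        (im_iteratedDeriv_ofReal XiDerivStrip.differentiable_xiUpper im_riemannXiUpper_ofReal_holds m),
        hw, map_zero]
    obtain ⟨a, ha, haim, h1, h2⟩ := exists_zero_of_iteratedDeriv_riemannXiUpper m hrefl
      (by rw [conj_im]; linarith)
    rw [conj_im, conj_re] at *
    refine ⟨a, ha, haim.ne', ?_, ?_⟩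
    · rw [abs_of_neg hneg, abs_of_pos haim]; exact h1
    · rw [abs_of_pos haim]; exact h2
  · obtain ⟨a, ha, haim, h1, h2⟩ := exists_zero_of_iteratedDeriv_riemannXiUpper m hw hpos
    refine ⟨a, ha, haim.ne', ?_, ?_⟩
    · rw [abs_of_pos hpos, abs_of_pos haim]; exact h1
    · rw [abs_of_pos haim]; exact h2

end XiDerivOffLine

/-- **A zero of `ξ^{(m)}` off the critical line is shadowed by a zero of `ζ` off the line**: if
`ξ^{(m)}(s) = 0` with `Re s ≠ ½`, then there is a zero `ρ` of `ζ` with `0 < Re ρ < 1`, `Re ρ ≠ ½`,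
`|Re s − ½| ≤ |Re ρ − ½|` and `|Im s − Im ρ| ≤ m |Re ρ − ½|` (iterated Jensen circles for `Ξ`).
[cite: KiKim2000, §2 p. 50 (Jensen's theorem)] [cite: Conrey1983, §1 (p. 49)] -/
theorem exists_offline_zeta_zero_of_iteratedDeriv_riemannXi_eq_zero (m : ℕ) {s : ℂ}
    (hs : iteratedDeriv m riemannXi s = 0) (hsre : s.re ≠ 1 / 2) :
    ∃ ρ : ℂ, riemannZeta ρ = 0 ∧ 0 < ρ.re ∧ ρ.re < 1 ∧ ρ.re ≠ 1 / 2 ∧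
      |s.re - 1 / 2| ≤ |ρ.re - 1 / 2| ∧ |s.im - ρ.im| ≤ m * |ρ.re - 1 / 2| := by
  set w : ℂ := -I * (s - 1 / 2) with hw
  have hsw : 1 / 2 + I * w = s := by rw [hw]; ring_nf; rw [I_sq]; ring
  have hwim : w.im = -(s.re - 1 / 2) := by simp [hw]
  have hwre : w.re = s.im := by simp [hw]
  have hzero : iteratedDeriv m riemannXiUpper w = 0 := by
    rw [iteratedDeriv_riemannXiUpper, hsw, hs, mul_zero]
  have hwim0 : w.im ≠ 0 := by rw [hwim]; intro h; apply hsre; linarith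
  obtain ⟨a, ha, haim, h1, h2⟩ := XiDerivOffLine.exists_zero_of_iteratedDeriv_riemannXiUpper' m hzero hwim0
  -- `a ↔ ρ = ½ + i a`
  set ρ : ℂ := 1 / 2 + I * a with hρ
  have hρre : ρ.re = 1 / 2 - a.im := by simp [hρ]; ring
  have hρim : ρ.im = a.re := by simp [hρ]
  have hξ : riemannXi ρ = 0 := by
    have : riemannXiUpper a = riemannXi (1 / 2 + I * a) := rfl
    rw [hρ, ← this, ha]
  obtain ⟨hζ, h0, h1'⟩ := (riemannXi_eq_zero_iff_holds ρ).1 hξ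
  refine ⟨ρ, hζ, h0, h1', ?_, ?_, ?_⟩
  · rw [hρre]; intro h; apply haim; linarith
  · rw [hρre, show 1 / 2 - a.im - 1 / 2 = -a.im by ring, abs_neg]
    rw [hwim, abs_neg] at h1
    exact h1
  · rw [hρim, hρre, show 1 / 2 - a.im - 1 / 2 = -a.im by ring, abs_neg, ← hwre]
    exact h2

/-- **RH up to height `T` puts the zeros of `ξ^{(m)}` up to height `T − m/2` on the line**: if every
zero of `ζ` in the critical strip with `|Im ρ| ≤ T` has `Re ρ = ½` (`RiemannHypothesisInStripUpTo T`),
then every zero `s` of `ξ^{(m)}` with `|Im s| ≤ T − m/2` has `Re s = ½`.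
[cite: KiKim2000, §2 p. 50 (Jensen's theorem)] [cite: Conrey1983, §1 (p. 49)] -/
theorem iteratedDeriv_riemannXi_zeros_on_line_of_rhUpTo {T : ℝ} (hT : RiemannHypothesisInStripUpTo T)
    (m : ℕ) {s : ℂ} (hs : iteratedDeriv m riemannXi s = 0) (him : |s.im| ≤ T - m / 2) :
    s.re = 1 / 2 := by
  by_contra hsre
  obtain ⟨ρ, hζ, h0, h1, hρre, -, h3⟩ :=
    exists_offline_zeta_zero_of_iteratedDeriv_riemannXi_eq_zero m hs hsre
  have hhalf : |ρ.re - 1 / 2| < 1 / 2 := by rw [abs_lt]; constructor <;> linarith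
  have hm0 : (0 : ℝ) ≤ m := Nat.cast_nonneg _
  have hρim : |ρ.im| ≤ T := by
    have h4 : |ρ.im| ≤ |s.im| + |s.im - ρ.im| := by
      have := abs_sub_abs_le_abs_sub s.im ρ.im
      have := abs_sub_comm s.im ρ.im
      linarith [abs_sub_abs_le_abs_sub ρ.im s.im]
    nlinarith
  exact hρre (hT ρ hζ h0 h1 hρim)

/-- **Unconditionally: every zero of `ξ^{(m)}` with `|Im s| ≤ 101 − m/2` lies on the critical line**
(the tree's kernel-checked certificate `riemannHypothesisInStripUpTo_hundredOne`: RH holds up to height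
`101`). [cite: KiKim2000, §2 p. 50 (Jensen's theorem)] [cite: Conrey1983, §1 (p. 49)] -/
theorem iteratedDeriv_riemannXi_zeros_on_line_upTo (m : ℕ) {s : ℂ}
    (hs : iteratedDeriv m riemannXi s = 0) (him : |s.im| ≤ 101 - m / 2) : s.re = 1 / 2 :=
  iteratedDeriv_riemannXi_zeros_on_line_of_rhUpTo riemannHypothesisInStripUpTo_hundredOne m hs him

/-- In particular **every zero of `ξ′` with `|Im s| ≤ 100.5` lies on the critical line.**
[cite: KiKim2000, §2 p. 50 (Jensen's theorem)] [cite: Conrey1983, §1 (p. 49)] -/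
theorem deriv_riemannXi_zeros_on_line_upTo {s : ℂ} (hs : deriv riemannXi s = 0)
    (him : |s.im| ≤ 100.5) : s.re = 1 / 2 :=
  iteratedDeriv_riemannXi_zeros_on_line_upTo 1 (by rw [iteratedDeriv_one]; exact hs)
    (by norm_num at him ⊢; exact him)

end Literature.NumberTheory.LFunctions

end
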